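import Literature.AlgebraicGeometry.Motives.MixedHodgeStructureCatTensorStructure
import Literature.AlgebraicGeometry.Motives.MixedHodgeStructureDualSubobjects
import HarnessLib

/-!
# Duality versus tensor products in `MixedHodgeStructureCat`: `(X ⊗ Y)^∨ ≅ X^∨ ⊗ Y^∨`, `ℚ(0)^∨ ≅ ℚ(0)`, `(X(n))^∨ = X^∨(−n)`

Layer `Literature/AlgebraicGeometry/Motives` (lane `lit-hodgefound`), continuing g45-#9 ∕ #10 (`transposeHom`, `dualFunctor`), #13 ∕ #14 (`tensorObj`, `tensorHom`,
`unitObj`, `ihomUnitIso`, `ihomIntoUnitIso`).  The tree proves, unbundled, that `(H₁ ⊗ H₂)^∨ → H₁^∨ ⊗ H₂^∨` (`tensorDualHom`, inverse `dualDistribHom` with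
underlying map Mathlib's `TensorProduct.dualDistrib`; `Motives/MixedHodgeStructureInternalHomCurry`) is an isomorphism of MHS and that `(H(j))^∨ = H^∨(−j)`
(`dual_tateTwist`, `Motives/MixedHodgeStructureDualSubobjects`).  Categorically:

* §1 **`dualTensorIso X Y : (X ⊗ Y)^∨ ≅ X^∨ ⊗ Y^∨`** with its value on `φ ⊗ ψ` and its NATURALITY against transposes
  (**`transposeHom_tensorHom_comp_dualTensorIso_hom : (f ⊗ g)^∨ ≫ (≅) = (≅) ≫ (f^∨ ⊗ g^∨)`**) — duality is compatible with `⊗`;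
* §2 **`unitDualIso : ℚ(0)^∨ ≅ ℚ(0)`** (`f ↦ f(1)`; through `Hom(ℚ(0), ℚ(0))`, g45-#14);
* §3 **`dualTateTwistIso n X : (X(n))^∨ ≅ X^∨(−n)`** (an equality of mixed Hodge structures on `X^∨`);
* §4 the transpose of the symmetry `β_{X,Y}` is the symmetry `β_{Y^∨,X^∨}` under these isomorphisms;
* §5 on the finite-dimensional full subcategory (g45-#10 `dualFunctor`, g45-#15 `tensorLeft`): the natural isomorphism
  **`dualFunctorTensorLeftIso X : (X ⊗ −)^∨ ≅ X^∨ ⊗ (−)^∨`** and **`dualObjFinUnitObjIso : 𝟙^∨ ≅ 𝟙`** — `(−)^∨` is a (contravariant) tensor functor.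

Everything is PROVED; no named fact, no instance, no notation (data: the isomorphisms).

Sources, verbatim (through the tree's files).  E. Cattani et al. (eds.), *Hodge Theory* (2014) [CattaniElZeinGriffithsLe2014], Ch. 3 §3.2.2.7 p. 163 (dual and tensor
product of MHS «by the general rules of filtrations»), Ex. 3.2.23 (4) (Tate twist), Thm. 3.2.18 (strictness: bijective morphisms are isomorphisms).  P. Deligne,
*Théorie de Hodge II* (1971) [DeligneHodgeII1971], 1.1.6 (dual filtration), 1.1.12 (tensor products), 2.1.13.  P. Deligne, J. S. Milne, *Tannakian categories*
(1982) [DeligneMilne1982Tannakian], §1 (1.7) («`(X ⊗ Y)^∨ = X^∨ ⊗ Y^∨`» in a rigid tensor category).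

## Main results

* §1 **`dualTensorIso`** (`_hom`, `_inv`, `_inv_toLinearMap`, `_inv_toLinearMap_apply_tmul`, `_hom_toLinearMap_dualDistrib`),
  `dualTensorIso_inv_comp_transposeHom_tensorHom`, **`transposeHom_tensorHom_comp_dualTensorIso_hom`**.
* §2 **`unitDualIso`**, `unitDualIso_hom_toLinearMap_apply`.
* §3 **`dualTateTwistIso`**, `dualTateTwistIso_hom_toLinearMap_apply`.
* §4 `dualTensorIso_inv_comp_transposeHom_braiding`, **`transposeHom_braiding_comp_dualTensorIso_hom`** (`β^∨` is the braiding of the duals).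
* §5 **`dualFunctorTensorLeftIso X : (tensorLeft X).op ⋙ dualFunctor ≅ dualFunctor ⋙ tensorLeft (dualObj X)`** (`_hom_app_hom`), **`dualObjFinUnitObjIso : dualObj finUnitObj ≅ finUnitObj`**.

## References

* [CattaniElZeinGriffithsLe2014] E. Cattani et al. (eds.), Hodge Theory, Princeton Math. Notes 49 (2014), Ch. 3 §3.2.2.7 p. 163, Ex. 3.2.23 (4), Thm. 3.2.18.
* [DeligneHodgeII1971] P. Deligne, Théorie de Hodge II, Publ. Math. IHÉS 40 (1971), 1.1.6, 1.1.12, 2.1.13.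
* [DeligneMilne1982Tannakian] P. Deligne, J. S. Milne, Tannakian categories, in LNM 900 (1982), §1 (1.7).

## Provenance

Lane `lit-hodgefound` (summit `HodgeConjecture`), seat `lit-hodgefound-p36` (literature-prover, generation 45, row g45-#18).
-/

noncomputable section

open CategoryTheory CategoryTheory.Limits
open scoped TensorProduct

namespace Literature.AlgebraicGeometry.Motives

universe u

namespace MixedHodgeStructureCat

variable {X X' Y Y' : MixedHodgeStructureCat.{u}} [Module.Finite ℚ X] [Module.Finite ℚ X'] [Module.Finite ℚ Y] [Module.Finite ℚ Y']

/-! ## §1 `(X ⊗ Y)^∨ ≅ X^∨ ⊗ Y^∨` -/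

variable (X Y) in
/-- **`(X ⊗ Y)^∨ ≅ X^∨ ⊗ Y^∨`** in `MixedHodgeStructureCat` (the tree's `tensorDualHom` ∕ `dualDistribHom`). [cite: CattaniElZeinGriffithsLe2014, Ch. 3 §3.2.2.7 p. 163]
[cite: DeligneMilne1982Tannakian, §1 (1.7)] -/
def dualTensorIso : of (tensorObj X Y).str.dual ≅ tensorObj (of X.str.dual) (of Y.str.dual) where
  hom := MixedHodgeStructure.tensorDualHom X.str Y.str
  inv := MixedHodgeStructure.dualDistribHom X.str Y.str
  hom_inv_id := MixedHodgeStructure.dualDistribHom_comp_tensorDualHom X.str Y.str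
  inv_hom_id := MixedHodgeStructure.tensorDualHom_comp_dualDistribHom X.str Y.str

variable (X Y) in
/-- Unfolding `dualTensorIso` (hom). [cite: CattaniElZeinGriffithsLe2014, Ch. 3 §3.2.2.7 p. 163] -/
theorem dualTensorIso_hom : (dualTensorIso X Y).hom = MixedHodgeStructure.tensorDualHom X.str Y.str := rfl

variable (X Y) in
/-- Unfolding `dualTensorIso` (inv). [cite: CattaniElZeinGriffithsLe2014, Ch. 3 §3.2.2.7 p. 163] -/
theorem dualTensorIso_inv : (dualTensorIso X Y).inv = MixedHodgeStructure.dualDistribHom X.str Y.str := rfl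

variable (X Y) in
/-- The underlying map of `X^∨ ⊗ Y^∨ → (X ⊗ Y)^∨` is Mathlib's `TensorProduct.dualDistrib`. [cite: CattaniElZeinGriffithsLe2014, Ch. 3 §3.2.2.7 p. 163] -/
theorem dualTensorIso_inv_toLinearMap : (dualTensorIso X Y).inv.toLinearMap = TensorProduct.dualDistrib ℚ X Y :=
  MixedHodgeStructure.dualDistribHom_toLinearMap X.str Y.str

/-- `(X^∨ ⊗ Y^∨ → (X ⊗ Y)^∨)(φ ⊗ ψ)(x ⊗ y) = φ(x) ψ(y)`. [cite: CattaniElZeinGriffithsLe2014, Ch. 3 §3.2.2.7 p. 163] -/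
theorem dualTensorIso_inv_toLinearMap_apply_tmul (φ : Module.Dual ℚ X) (ψ : Module.Dual ℚ Y) (x : X) (y : Y) :
    (dualTensorIso X Y).inv.toLinearMap (φ ⊗ₜ[ℚ] ψ) (x ⊗ₜ[ℚ] y) = φ x * ψ y := by
  rw [dualTensorIso_inv_toLinearMap, TensorProduct.dualDistrib_apply]

/-- `((X ⊗ Y)^∨ → X^∨ ⊗ Y^∨)` sends the functional `x ⊗ y ↦ φ(x) ψ(y)` to `φ ⊗ ψ`. [cite: CattaniElZeinGriffithsLe2014, Ch. 3 §3.2.2.7 p. 163] -/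
theorem dualTensorIso_hom_toLinearMap_dualDistrib (φ : Module.Dual ℚ X) (ψ : Module.Dual ℚ Y) :
    (dualTensorIso X Y).hom.toLinearMap (TensorProduct.dualDistrib ℚ X Y (φ ⊗ₜ[ℚ] ψ)) = φ ⊗ₜ[ℚ] ψ :=
  MixedHodgeStructure.tensorDualHom_toLinearMap_dualDistrib X.str Y.str φ ψ

/-- Naturality, inverse form: `(X'^∨ ⊗ Y'^∨ ≅ (X' ⊗ Y')^∨) ≫ (f ⊗ g)^∨ = (f^∨ ⊗ g^∨) ≫ (X^∨ ⊗ Y^∨ ≅ (X ⊗ Y)^∨)`. [cite: DeligneHodgeII1971, 1.1.6 and 1.1.12] -/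
theorem dualTensorIso_inv_comp_transposeHom_tensorHom (f : X ⟶ X') (g : Y ⟶ Y') :
    (dualTensorIso X' Y').inv ≫ transposeHom (tensorHom f g) = tensorHom (transposeHom f) (transposeHom g) ≫ (dualTensorIso X Y).inv := by
  apply hom_ext
  refine TensorProduct.ext' fun φ ψ => ?_
  refine TensorProduct.ext' fun x y => ?_
  rw [comp_toLinearMap, comp_toLinearMap, LinearMap.comp_apply, LinearMap.comp_apply, transposeHom_toLinearMap, LinearMap.dualMap_apply,
    tensorHom_toLinearMap_apply_tmul, dualTensorIso_inv_toLinearMap_apply_tmul, tensorHom_toLinearMap_apply_tmul, dualTensorIso_inv_toLinearMap_apply_tmul,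
    transposeHom_toLinearMap, transposeHom_toLinearMap, LinearMap.dualMap_apply, LinearMap.dualMap_apply]

/-- **Naturality of `(X ⊗ Y)^∨ ≅ X^∨ ⊗ Y^∨`: `(f ⊗ g)^∨ ≫ (≅) = (≅) ≫ (f^∨ ⊗ g^∨)`** — duality is a (contravariant) tensor functor. [cite: DeligneHodgeII1971, 1.1.6 and 1.1.12]
[cite: DeligneMilne1982Tannakian, §1 (1.7)] -/
theorem transposeHom_tensorHom_comp_dualTensorIso_hom (f : X ⟶ X') (g : Y ⟶ Y') :
    transposeHom (tensorHom f g) ≫ (dualTensorIso X Y).hom = (dualTensorIso X' Y').hom ≫ tensorHom (transposeHom f) (transposeHom g) := by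
  rw [← cancel_epi (dualTensorIso X' Y').inv, ← Category.assoc, dualTensorIso_inv_comp_transposeHom_tensorHom, Category.assoc, Iso.inv_hom_id,
    Category.comp_id, Iso.inv_hom_id_assoc]

/-! ## §2 `ℚ(0)^∨ ≅ ℚ(0)` -/

/-- **The unit is self-dual: `ℚ(0)^∨ ≅ ℚ(0)`** — through `ℚ(0)^∨ ≅ Hom(ℚ(0), ℚ(0)) ≅ ℚ(0)` (g45-#14 `ihomIntoUnitIso`, `ihomUnitIso`). [cite: DeligneHodgeII1971, 1.1.6 and 2.1.13]
[cite: DeligneMilne1982Tannakian, §1 (1.7)] -/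
def unitDualIso : of unitObj.{u}.str.dual ≅ unitObj.{u} := (ihomIntoUnitIso unitObj.{u}).symm ≪≫ ihomUnitIso unitObj.{u}

/-- `unitDualIso f = f(1)`. [cite: DeligneHodgeII1971, 2.1.13] -/
theorem unitDualIso_hom_toLinearMap_apply (f : Module.Dual ℚ unitObj.{u}) : unitDualIso.hom.toLinearMap f = ULift.up (f (ULift.up 1)) := by
  have h1 : (ihomIntoUnitIso unitObj.{u}).hom.toLinearMap ((uliftRatEquiv.{u}).symm.toLinearMap ∘ₗ f) = f := by
    refine LinearMap.ext fun y => ?_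
    rw [ihomIntoUnitIso_hom, ihomIntoUnitHom_toLinearMap_apply]
    rfl
  have h2 : (ihomIntoUnitIso unitObj.{u}).inv.toLinearMap f = (uliftRatEquiv.{u}).symm.toLinearMap ∘ₗ f := by
    conv_lhs => rw [← h1]
    rw [← LinearMap.comp_apply, ← comp_toLinearMap, Iso.hom_inv_id]
    rfl
  change (ihomUnitIso unitObj.{u}).hom.toLinearMap ((ihomIntoUnitIso unitObj.{u}).inv.toLinearMap f) = _
  rw [h2, ihomUnitIso_hom, ihomUnitHom_toLinearMap_apply]
  rfl

/-! ## §3 `(X(n))^∨ = X^∨(−n)` -/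

variable (X) in
/-- **`(X(n))^∨ ≅ X^∨(−n)`**: the tree's EQUALITY of mixed Hodge structures `(H(n))^∨ = H^∨(−n)` on `X^∨` (`dual_tateTwist`), as an isomorphism of objects (`eqToIso`;
`(tateTwist n).obj X = of (X.str.tateTwist n)` by `rfl`). [cite: CattaniElZeinGriffithsLe2014, Ex. 3.2.23 (4)] [cite: DeligneHodgeII1971, 1.1.6 and 2.1.13] -/
def dualTateTwistIso (n : ℤ) : of (X.str.tateTwist n).dual ≅ (tateTwist (-n)).obj (of X.str.dual) :=
  eqToIso (congrArg of (MixedHodgeStructure.dual_tateTwist X.str n))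

variable (X) in
/-- `dualTateTwistIso` is the identity on vectors. [cite: CattaniElZeinGriffithsLe2014, Ex. 3.2.23 (4)] -/
theorem dualTateTwistIso_hom_toLinearMap_apply (n : ℤ) (φ : Module.Dual ℚ X) : (dualTateTwistIso X n).hom.toLinearMap φ = φ := by
  have h : ∀ {A B : MixedHodgeStructureCat.{u}} (e : A = B) (v : A), (eqToHom e).toLinearMap v = cast (congrArg (fun C : MixedHodgeStructureCat.{u} => (C : Type u)) e) v := by
    intro A B e v
    subst e
    rfl
  rw [dualTateTwistIso, eqToIso.hom, h]
  rfl

/-! ## §4 Duality and the braiding -/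

variable (X Y) in
/-- Inverse form of `transposeHom_braiding_comp_dualTensorIso_hom`. [cite: DeligneMilne1982Tannakian, §1 (1.7)] -/
theorem dualTensorIso_inv_comp_transposeHom_braiding :
    (dualTensorIso Y X).inv ≫ transposeHom (braiding X Y).hom = (braiding (of Y.str.dual) (of X.str.dual)).hom ≫ (dualTensorIso X Y).inv := by
  apply hom_ext
  refine TensorProduct.ext' fun ψ φ => ?_
  refine TensorProduct.ext' fun x y => ?_
  rw [comp_toLinearMap, comp_toLinearMap, LinearMap.comp_apply, LinearMap.comp_apply, transposeHom_toLinearMap, LinearMap.dualMap_apply,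
    braiding_hom_toLinearMap_apply_tmul, dualTensorIso_inv_toLinearMap_apply_tmul, braiding_hom_toLinearMap_apply_tmul, dualTensorIso_inv_toLinearMap_apply_tmul,
    mul_comm]

variable (X Y) in
/-- **The transpose of the symmetry is the symmetry of the duals**: `(β_{X,Y})^∨ ≫ ((X ⊗ Y)^∨ ≅ X^∨ ⊗ Y^∨) = ((Y ⊗ X)^∨ ≅ Y^∨ ⊗ X^∨) ≫ β_{Y^∨,X^∨}`.
[cite: DeligneMilne1982Tannakian, §1 (1.7)] -/
theorem transposeHom_braiding_comp_dualTensorIso_hom :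
    transposeHom (braiding X Y).hom ≫ (dualTensorIso X Y).hom = (dualTensorIso Y X).hom ≫ (braiding (of Y.str.dual) (of X.str.dual)).hom := by
  rw [← cancel_epi (dualTensorIso Y X).inv, ← Category.assoc, dualTensorIso_inv_comp_transposeHom_braiding, Category.assoc, Iso.inv_hom_id,
    Category.comp_id, Iso.inv_hom_id_assoc]

/-! ## §5 On the finite-dimensional subcategory: `(X ⊗ −)^∨ ≅ X^∨ ⊗ (−)^∨` and `𝟙^∨ ≅ 𝟙` for `dualFunctor` -/

/-- **`(X ⊗ −)^∨ ≅ X^∨ ⊗ (−)^∨`** as functors `FinSubcategoryᵒᵖ ⥤ FinSubcategory`: the duality functor `dualFunctor` (g45-#10) is compatible with `X ⊗ −`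
(components `dualTensorIso`, naturality `transposeHom_tensorHom_comp_dualTensorIso_hom`). [cite: DeligneMilne1982Tannakian, §1 (1.7)] [cite: DeligneHodgeII1971, 1.1.6 and 1.1.12] -/
def dualFunctorTensorLeftIso (X : FinSubcategory.{u}) : (tensorLeft X).op ⋙ dualFunctor.{u} ≅ dualFunctor.{u} ⋙ tensorLeft (dualObj X) :=
  NatIso.ofComponents
    (fun Y =>
      haveI : Module.Finite ℚ X.obj := X.property
      haveI : Module.Finite ℚ Y.unop.obj := Y.unop.property
      isFinite.isoMk (dualTensorIso X.obj Y.unop.obj))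
    (fun {Y Y'} g => by
      apply isFinite.hom_ext
      haveI : Module.Finite ℚ X.obj := X.property
      haveI : Module.Finite ℚ Y.unop.obj := Y.unop.property
      haveI : Module.Finite ℚ Y'.unop.obj := Y'.unop.property
      change transposeHom (tensorHom (𝟙 X.obj) g.unop.hom) ≫ (dualTensorIso X.obj Y'.unop.obj).hom =
        (dualTensorIso X.obj Y.unop.obj).hom ≫ tensorHom (𝟙 (of X.obj.str.dual)) (transposeHom g.unop.hom)
      rw [transposeHom_tensorHom_comp_dualTensorIso_hom, transposeHom_id])

/-- The components of `dualFunctorTensorLeftIso X` are the `dualTensorIso X Y`. [cite: DeligneMilne1982Tannakian, §1 (1.7)] -/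
theorem dualFunctorTensorLeftIso_hom_app_hom (X : FinSubcategory.{u}) (Y : FinSubcategory.{u}ᵒᵖ) :
    ((dualFunctorTensorLeftIso X).hom.app Y).hom =
      haveI : Module.Finite ℚ X.obj := X.property
      haveI : Module.Finite ℚ Y.unop.obj := Y.unop.property
      (dualTensorIso X.obj Y.unop.obj).hom := rfl

/-- **`𝟙^∨ ≅ 𝟙` on the finite-dimensional subcategory**: `dualFunctor` preserves the unit (`unitDualIso`). [cite: DeligneMilne1982Tannakian, §1 (1.7)] -/
def dualObjFinUnitObjIso : dualObj finUnitObj.{u} ≅ finUnitObj.{u} := isFinite.isoMk unitDualIso.{u}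

/-- Unfolding `dualObjFinUnitObjIso`. [cite: DeligneMilne1982Tannakian, §1 (1.7)] -/
theorem dualObjFinUnitObjIso_hom_hom : dualObjFinUnitObjIso.{u}.hom.hom = unitDualIso.{u}.hom := rfl

end MixedHodgeStructureCat

end Literature.AlgebraicGeometry.Motives
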